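import Summits.Ventures.YMGap.RobustBall.ZTwoLayerIsing
import Summits.Ventures.YMGap.RobustBall.ZNGaugePeeling
import HarnessLib

/-!
# RobustBall/CentreBlindZ2Domination — MACK–PETKOVA DOMINATION FOR THE WHOLE LINKWISE CENTRE-BLIND CLASS (`SU(2)`):
# `|⟨W_{R×T}⟩_{β,W,L}| ≤ ⟨σ(∂R×T)⟩^{ℤ₂-LGT}_{L, β_W}`, `β_W = 2|β|` — every Wilson loop of every member of the class is bounded by the
# SAME Wilson loop of ISING (`ℤ₂`) LATTICE GAUGE THEORY on the same torus at the Wilson coupling `β_W`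

HONEST FRAMING: venture file of the cell `pub-ymgap` (QuantumFields programme), track Y2 ROBUST-BALL / DS seat ds-4 (g12).  WHAT THIS IS: an
INEQUALITY BETWEEN LATTICE EXPECTATIONS on a finite torus `(ℤ/L)^d`, for `SU(2)`, EVERY `d`, EVERY `L`, EVERY tree coupling `β`, EVERY
rectangle `R × T` (wrapping or not) and EVERY perturbation `W` of the Wilson action that is twist-blind (in particular every LINKWISE CENTRE-BLIND
`W` of rb-theory's class `IsCentreBlind`, NO smallness / range / window):

  `|⟨(1/2) tr U_{∂R×T}⟩_{β,W,L}| ≤ z2Loop (2|β|) x i j R T = ⟨∏_{e ∈ ∂R×T} σ_e⟩_{ℤ₂-LGT, (ℤ/L)^d, β_W}`     (`su2_abs_wilsonLoop_le_z2Loop`),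

the right side being the Wilson loop of the ℤ₂ lattice gauge theory `ν ∝ exp(β_W ∑_p σ_{∂p})` on the links of the same torus (a Friedli–Velenik
ferromagnetic spin system `gksExpect` with index set = plaquettes, supports = the four links of a plaquette; `z2Loop`), equivalently the induced
`ℤ₂` loop `znLoop` of `CentreProjection` in the TRIVIAL background `U ≡ 1` at `|β|` (`z2Loop_eq_re_znLoop_one`).
MECHANISM (G. Mack, V. B. Petkova, Ann. Phys. 123 (1979) 442, §2 — there for the pure Wilson action; J. Fröhlich, Phys. Lett. B 83 (1979) 195):
the centre projection of the tree (`abs_expectation_wilsonLoop_le_of_isTwistBlind`: `|⟨W⟩| ≤ sup_U ‖znLoop β U‖`, the Wilson loop of the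
INHOMOGENEOUS `ℤ₂` gauge theory with plaquette couplings `J_p(U) = β Re tr U_p`, `|J_p| ≤ 2|β|`) followed by GRIFFITHS' COMPARISON for generalised
Ising ferromagnets (`ZTwo.abs_gksExpect_spinProduct_le`: `|⟨σ_A⟩_{J}| ≤ ⟨σ_A⟩_{|J|↑}`), once the induced theory is written as a Friedli–Velenik spin
system on the LINKS (`znWeight_two_eq_gksWeight`, `znLoop_two_eq_gksExpect`; the loop observable `ψ₂(∮k)` is the spin product over the ODD
SUPPORT of the boundary links, `sgn_loopSum`, so no non-wrapping hypothesis is needed).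
CONSEQUENCES (all kernel facts of this file): the class bound is MONOTONE in `β_W` and lies in `[0, 1]` (`z2Loop_nonneg`, `z2Loop_le_one`,
`z2Loop_mono`); every upper bound on Ising-lattice-gauge-theory Wilson loops on tori at `β_W` is a bound for the whole class at `β = β_W/2` — the
tree's rungs 1–∞ (`CentreBlindAreaLaw` … `CentreBlindSubcritical`) are such bounds obtained by decoupling the layers; conversely the window of ANY
statement uniform over the class is at most the confinement window of `ℤ₂` lattice gauge theory (`d = 4`: `β_W ≈ 0.44`, numerics, not a theorem here).
HONEST LABEL: `SU(2)` only (the comparison inequality is Griffiths', `N = 2`); finite tori; no area law is asserted in this file; nothing continuum /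
spectral / Clay.

References AS PRINTED: G. Mack, V. B. Petkova, Ann. Phys. 123 (1979) 442–467, §2 [MackPetkova1979]; J. Fröhlich, Phys. Lett. B 83 (1979) 195
[Frohlich1979ZN]; S. Friedli, Y. Velenik, *Statistical Mechanics of Lattice Systems* (2017), §3.8.1 (GKS for `ν_{Λ;K}`) [FriedliVelenik2017].
-/

noncomputable section

open Finset
open scoped symmDiff
open Literature.MathematicalPhysics.QuantumLattice (fundamentalRep)
open Literature.MathematicalPhysics.QuantumFieldTheory
open Literature.Probability.LatticeModels (SpinConfig spinAt spinProduct gksWeight gksExpect gksSum gksHamiltonian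
  spinProduct_mul_eq_spinProduct_symmDiff)

namespace Summit.Ventures.YMGap.RobustBall

namespace ZTwo

variable {d L : ℕ}

/-! ### Link spins: `ℤ/2`-valued link fields as `±1` spin configurations on the links -/

/-- The `±1` spin configuration on the LINKS of a `ℤ/2` link field `k`: `σ_e = ψ₂(k_e)`. [folklore] -/
def linkSpin (k : Edge d L → ZMod 2) : SpinConfig (Edge d L) :=
  fun e => if k e = 0 then 1 else -1

/-- `σ_e(linkSpin k) = sgn(k_e)`. [folklore] -/
@[simp] theorem spinAt_linkSpin (k : Edge d L → ZMod 2) (e : Edge d L) : spinAt e (linkSpin k) = sgn (k e) := by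
  unfold spinAt linkSpin sgn
  split_ifs <;> simp

/-- `linkSpin` is a bijection `(links → ℤ/2) ≃ SpinConfig links`. [folklore] -/
def linkSpinEquiv : (Edge d L → ZMod 2) ≃ SpinConfig (Edge d L) where
  toFun := linkSpin
  invFun ω := fun e => if ω e = 1 then 0 else 1
  left_inv k := by
    funext e
    by_cases h : k e = 0
    · simp [linkSpin, h]
    · simp [linkSpin, Literature.Probability.Percolation.Contour.zmod2_eq_one_of_ne_zero h]
  right_inv ω := by
    funext e
    rcases Int.units_eq_one_or (ω e) with h | h <;> simp [linkSpin, h]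

/-! ### Odd supports: `ψ₂` of a sum of link variables is the spin product over the links with odd multiplicity -/

/-- The ODD SUPPORT of an indexed family of links `g : α → links` over `s`: the links hit an odd number of times
(iterated symmetric difference of singletons). [folklore] -/
def oddSupport {α : Type*} (s : Finset α) (g : α → Edge d L) : Finset (Edge d L) :=
  s.fold (· ∆ ·) ∅ fun a => {g a}

/-- `spinProduct {e} = σ_e`. [folklore] -/
theorem spinProduct_singleton' (e : Edge d L) (ω : SpinConfig (Edge d L)) : spinProduct {e} ω = spinAt e ω := by
  simp [spinProduct]

/-- **`sgn(∑_{a ∈ s} k_{g a}) = σ_{oddSupport s g}(linkSpin k)`**. [folklore] -/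
theorem sgn_sum_eq_spinProduct {α : Type*} [DecidableEq α] (k : Edge d L → ZMod 2) (s : Finset α) (g : α → Edge d L) :
    sgn (∑ a ∈ s, k (g a)) = spinProduct (oddSupport s g) (linkSpin k) := by
  induction s using Finset.induction_on with
  | empty => simp [oddSupport]
  | insert a s ha ih =>
    simp only [oddSupport] at ih ⊢
    rw [Finset.sum_insert ha, sgn_add, ih, Finset.fold_insert ha, ← spinProduct_mul_eq_spinProduct_symmDiff,
      spinProduct_singleton', spinAt_linkSpin]

/-! ### The induced `ℤ₂` gauge theory as a Friedli–Velenik spin system on the links -/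

/-- The four links of the plaquette `p = (x; i < j)` as an odd support: `{(x,i)} ∆ {(x+eᵢ,j)} ∆ {(x+eⱼ,i)} ∆ {(x,j)}` (for `L ≥ 2` these are
four distinct links and this is just their set). [folklore] -/
def plaqLinks (p : Plaquette d L) : Finset (Edge d L) :=
  (({(p.1, p.2.1.1)} : Finset (Edge d L)) ∆ {(p.1.shift p.2.1.1, p.2.1.2)}) ∆ {(p.1.shift p.2.1.2, p.2.1.1)} ∆ {(p.1, p.2.1.2)}

/-- **`sgn((curl k)_p) = σ_{plaqLinks p}(linkSpin k)`**. [folklore] -/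
theorem sgn_plaqSum (k : Edge d L → ZMod 2) (p : Plaquette d L) :
    sgn (plaqSum k p.1 p.2.1.1 p.2.1.2) = spinProduct (plaqLinks p) (linkSpin k) := by
  unfold plaqSum plaqLinks
  rw [sgn_sub, sgn_sub, sgn_add, ← spinProduct_mul_eq_spinProduct_symmDiff, ← spinProduct_mul_eq_spinProduct_symmDiff,
    ← spinProduct_mul_eq_spinProduct_symmDiff]
  simp only [spinProduct_singleton', spinAt_linkSpin]

/-- The plaquette couplings of the induced `ℤ₂` gauge theory in the background `U`: `J_p(U) = β · Re tr U_p`. [folklore] -/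
def z2Coupling (β : ℝ) (U : GaugeConfig d L (SUN 2)) (p : Plaquette d L) : ℝ :=
  β * ((plaquetteHolonomy U p.1 p.2.1.1 p.2.1.2 : SUN 2) : Matrix (Fin 2) (Fin 2) ℂ).trace.re

/-- `|J_p(U)| ≤ 2|β|`. [folklore] -/
theorem abs_z2Coupling_le (β : ℝ) (U : GaugeConfig d L (SUN 2)) (p : Plaquette d L) : |z2Coupling β U p| ≤ 2 * |β| := by
  unfold z2Coupling
  rw [abs_mul]
  have h : |((plaquetteHolonomy U p.1 p.2.1.1 p.2.1.2 : SUN 2) : Matrix (Fin 2) (Fin 2) ℂ).trace.re| ≤ 2 :=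
    (Complex.abs_re_le_norm _).trans (by simpa using norm_trace_le (plaquetteHolonomy U p.1 p.2.1.1 p.2.1.2 : SUN 2))
  calc |β| * |((plaquetteHolonomy U p.1 p.2.1.1 p.2.1.2 : SUN 2) : Matrix (Fin 2) (Fin 2) ℂ).trace.re| ≤ |β| * 2 :=
      mul_le_mul_of_nonneg_left h (abs_nonneg β)
    _ = 2 * |β| := by ring

/-- In the trivial background every coupling is `2β`: `J_p(1) = β · Re tr 1 = 2β`. [folklore] -/
theorem z2Coupling_one [NeZero L] (β : ℝ) (p : Plaquette d L) : z2Coupling β (1 : GaugeConfig d L (SUN 2)) p = 2 * β := by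
  unfold z2Coupling plaquetteHolonomy
  simp only [Pi.one_apply, mul_one, inv_one, OneMemClass.coe_one, Matrix.trace_one, Fintype.card_fin]
  norm_num
  ring

/-- **THE INDUCED `ℤ₂` GAUGE THEORY IS A FRIEDLI–VELENIK SPIN SYSTEM ON THE LINKS**: `znWeight β U k = ν`-weight with index set = all plaquettes,
couplings `J_p(U)`, supports `plaqLinks p`, configuration `linkSpin k`. [folklore] -/
theorem znWeight_two_eq_gksWeight [NeZero L] (β : ℝ) (U : GaugeConfig d L (SUN 2)) (k : Edge d L → ZMod 2) :
    znWeight β U k = gksWeight Finset.univ (z2Coupling β U) plaqLinks (linkSpin k) := by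
  unfold znWeight twistEnergy gksWeight gksHamiltonian z2Coupling
  congr 1
  rw [Finset.mul_sum]
  refine Finset.sum_congr rfl fun p _ => ?_
  rw [ψ_two_eq, Complex.re_ofReal_mul, sgn_plaqSum]
  ring

/-! ### The loop observable -/

/-- The links of the straight path of `n` steps in direction `m` from `y`, as an odd support. [folklore] -/
def lineLinks [NeZero L] (m : Fin d) (n : ℕ) (y : Site d L) : Finset (Edge d L) :=
  oddSupport (Finset.range n) fun r => (y + Pi.single m ((r : ℕ) : ZMod L), m)

/-- `sgn(lineSum k m n y) = σ_{lineLinks m n y}(linkSpin k)`. [folklore] -/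
theorem sgn_lineSum [NeZero L] (k : Edge d L → ZMod 2) (m : Fin d) (n : ℕ) (y : Site d L) :
    sgn (lineSum k m n y) = spinProduct (lineLinks m n y) (linkSpin k) := by
  rw [ZN.lineSum_eq_sum]
  exact sgn_sum_eq_spinProduct k _ _

/-- **The boundary of the `R × T` rectangle at `x` in the `(i, j)` plane as an odd support of links** (bottom ∆ right ∆ top ∆ left; for a
non-wrapping rectangle these are `2(R+T)` distinct links and this is just their set). [folklore] -/
def loopLinks [NeZero L] (x : Site d L) (i j : Fin d) (R T : ℕ) : Finset (Edge d L) :=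
  ((lineLinks i R x ∆ lineLinks j T (x + Pi.single i (R : ZMod L))) ∆ lineLinks i R (x + Pi.single j (T : ZMod L))) ∆ lineLinks j T x

/-- **`ψ₂(∮_{∂R×T} k) = σ_{loopLinks}(linkSpin k)`** — no hypothesis on `R, T, L`. [folklore] -/
theorem sgn_loopSum [NeZero L] (k : Edge d L → ZMod 2) (x : Site d L) (i j : Fin d) (R T : ℕ) :
    sgn (loopSum k x i j R T) = spinProduct (loopLinks x i j R T) (linkSpin k) := by
  unfold loopSum loopLinks
  rw [sgn_sub, sgn_sub, sgn_add, ← spinProduct_mul_eq_spinProduct_symmDiff, ← spinProduct_mul_eq_spinProduct_symmDiff,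
    ← spinProduct_mul_eq_spinProduct_symmDiff, sgn_lineSum, sgn_lineSum, sgn_lineSum, sgn_lineSum]

/-! ### The `ℤ₂` lattice gauge theory Wilson loop and the domination theorem -/

/-- **The Wilson loop of `ℤ₂` (Ising) lattice gauge theory on the torus `(ℤ/L)^d` at coupling `βW`**: `⟨σ_{∂R×T}⟩` under
`ν ∝ exp(βW ∑_p σ_{∂p})` (Friedli–Velenik spin system on the links, plaquette supports). [folklore] -/
def z2Loop [NeZero L] (βW : ℝ) (x : Site d L) (i j : Fin d) (R T : ℕ) : ℝ :=
  gksExpect (Finset.univ : Finset (Plaquette d L)) (fun _ => βW) plaqLinks (spinProduct (loopLinks x i j R T))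

/-- **The induced `ℤ₂` Wilson loop is a Friedli–Velenik correlation**: `znLoop β U = ⟨σ_{loopLinks}⟩_{univ; J(U)}`. [folklore] -/
theorem znLoop_two_eq_gksExpect [NeZero L] (β : ℝ) (U : GaugeConfig d L (SUN 2)) (x : Site d L) (i j : Fin d) (R T : ℕ) :
    znLoop β U x i j R T =
      (gksExpect (Finset.univ : Finset (Plaquette d L)) (z2Coupling β U) plaqLinks (spinProduct (loopLinks x i j R T)) : ℂ) := by
  classical
  set K := z2Coupling β U with hK
  have hw : ∀ k, znWeight β U k = gksWeight Finset.univ K plaqLinks (linkSpinEquiv k) := fun k => znWeight_two_eq_gksWeight β U k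
  have hobs : ∀ k : Edge d L → ZMod 2, ψ 2 (loopSum k x i j R T) = (spinProduct (loopLinks x i j R T) (linkSpinEquiv k) : ℂ) := by
    intro k
    rw [ψ_two_eq, sgn_loopSum]
    rfl
  unfold znLoop FiniteGibbs.cavg FiniteGibbs.mass gksExpect gksSum
  simp only [hw, hobs]
  have hnum : ∑ k : Edge d L → ZMod 2, ((gksWeight Finset.univ K plaqLinks (linkSpinEquiv k) : ℝ) : ℂ) *
        (spinProduct (loopLinks x i j R T) (linkSpinEquiv k) : ℂ) =
      ((∑ ω, spinProduct (loopLinks x i j R T) ω * gksWeight Finset.univ K plaqLinks ω : ℝ) : ℂ) := by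
    push_cast
    exact Fintype.sum_equiv linkSpinEquiv _ _ fun k => by ring
  have hden : ∑ k : Edge d L → ZMod 2, gksWeight Finset.univ K plaqLinks (linkSpinEquiv k) =
      ∑ ω, (fun _ => (1 : ℝ)) ω * gksWeight Finset.univ K plaqLinks ω :=
    Fintype.sum_equiv linkSpinEquiv _ _ fun k => by ring
  rw [hnum, hden]
  push_cast
  rfl

/-- **Griffiths' comparison for the induced `ℤ₂` loop**: `‖znLoop β U‖ ≤ z2Loop (2|β|)` for EVERY background `U`. [folklore] -/
theorem norm_znLoop_two_le_z2Loop [NeZero L] (β : ℝ) (U : GaugeConfig d L (SUN 2)) (x : Site d L) (i j : Fin d) (R T : ℕ) :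
    ‖znLoop β U x i j R T‖ ≤ z2Loop (2 * |β|) x i j R T := by
  classical
  rw [znLoop_two_eq_gksExpect, Complex.norm_real, Real.norm_eq_abs]
  exact abs_gksExpect_spinProduct_le _ _ (fun p _ => abs_z2Coupling_le β U p) _

/-- **The `ℤ₂` lattice gauge theory loop is the induced loop of the trivial background**: `z2Loop (2β) = Re znLoop β 1`. [folklore] -/
theorem z2Loop_eq_re_znLoop_one [NeZero L] (β : ℝ) (x : Site d L) (i j : Fin d) (R T : ℕ) :
    z2Loop (2 * β) x i j R T = (znLoop β (1 : GaugeConfig d L (SUN 2)) x i j R T).re := by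
  rw [znLoop_two_eq_gksExpect, Complex.ofReal_re, z2Loop]
  congr 1
  funext p
  rw [z2Coupling_one]

/-- **`0 ≤ z2Loop βW`** for `βW ≥ 0` (Griffiths' first inequality). [folklore] -/
theorem z2Loop_nonneg [NeZero L] {βW : ℝ} (hβ : 0 ≤ βW) (x : Site d L) (i j : Fin d) (R T : ℕ) : 0 ≤ z2Loop βW x i j R T :=
  Literature.Probability.LatticeModels.gksExpect_spinProduct_nonneg _ _ _ (fun _ _ => hβ) _

/-- **`z2Loop βW ≤ 1`**. [folklore] -/
theorem z2Loop_le_one [NeZero L] (βW : ℝ) (x : Site d L) (i j : Fin d) (R T : ℕ) : z2Loop βW x i j R T ≤ 1 := by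
  have h := norm_znLoop_le_one (N := 2) (βW / 2) (1 : GaugeConfig d L (SUN 2)) x i j R T
  have h2 : z2Loop βW x i j R T = (znLoop (βW / 2) (1 : GaugeConfig d L (SUN 2)) x i j R T).re := by
    rw [← z2Loop_eq_re_znLoop_one]; ring_nf
  rw [h2]
  exact (Complex.re_le_norm _).trans h

/-- **Monotonicity in the coupling** (Griffiths' second inequality): `|βW'| ≤ βW ⇒ z2Loop βW' ≤ z2Loop βW`. [folklore] -/
theorem z2Loop_mono [NeZero L] {βW βW' : ℝ} (h : |βW'| ≤ βW) (x : Site d L) (i j : Fin d) (R T : ℕ) :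
    z2Loop βW' x i j R T ≤ z2Loop βW x i j R T := by
  classical
  exact Literature.Probability.LatticeModels.gksExpect_mono_of_abs_le _ _ (fun _ _ => h) _

/-- **MACK–PETKOVA DOMINATION FOR THE CENTRE-BLIND CLASS** (`SU(2)`, every `d`, `L`, `β`, every rectangle, every twist-blind `W` — in particular
every linkwise centre-blind `W`, no smallness / range / window): `|⟨(1/2) tr U_{∂R×T}⟩_{β,W,L}| ≤ z2Loop (2|β|) x i j R T`, the Wilson loop of `ℤ₂`
lattice gauge theory on the same torus at `β_W = 2|β|`.  HONEST LABEL: an inequality between finite-torus expectations; no area law asserted.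
[cite: MackPetkova1979, §2] -/
theorem su2_abs_wilsonLoop_le_z2Loop [NeZero L] (W : Perturbation d L 2) (hW : IsTwistBlind W) (β : ℝ) (x : Site d L) (i j : Fin d)
    (R T : ℕ) :
    |W.expectation (fundamentalRep (Fin 2)) β (wilsonLoop (fundamentalRep (Fin 2)) x i j R T)| ≤ z2Loop (2 * |β|) x i j R T :=
  abs_expectation_wilsonLoop_le_of_isTwistBlind W hW β x i j R T fun U => norm_znLoop_two_le_z2Loop β U x i j R T

/-- The same for rb-theory's `IsCentreBlind`. [cite: MackPetkova1979, §2] -/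
theorem su2_abs_wilsonLoop_le_z2Loop_of_isCentreBlind [NeZero L] (W : Perturbation d L 2) (hW : IsCentreBlind W) (β : ℝ) (x : Site d L)
    (i j : Fin d) (R T : ℕ) :
    |W.expectation (fundamentalRep (Fin 2)) β (wilsonLoop (fundamentalRep (Fin 2)) x i j R T)| ≤ z2Loop (2 * |β|) x i j R T :=
  su2_abs_wilsonLoop_le_z2Loop W hW.isTwistBlind β x i j R T

/-- **TRANSFER PRINCIPLE**: any bound `B` on the `ℤ₂`-lattice-gauge-theory loop at `β_W = 2|β|` on the torus `(ℤ/L)^d` bounds the same loop for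
EVERY member of the class at tree coupling `β`. [cite: MackPetkova1979, §2] -/
theorem su2_abs_wilsonLoop_le_of_z2Loop_le [NeZero L] {β B : ℝ} {x : Site d L} {i j : Fin d} {R T : ℕ}
    (hB : z2Loop (2 * |β|) x i j R T ≤ B) (W : Perturbation d L 2) (hW : IsTwistBlind W) :
    |W.expectation (fundamentalRep (Fin 2)) β (wilsonLoop (fundamentalRep (Fin 2)) x i j R T)| ≤ B :=
  (su2_abs_wilsonLoop_le_z2Loop W hW β x i j R T).trans hB

end ZTwo

end Summit.Ventures.YMGap.RobustBall

end
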